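import Summits.Ventures.PercRepro.S2PaymentCell
import Summits.Ventures.PercRepro.S2CoindepCount
import Summits.Ventures.PercRepro.S2PhiSixteenFive
import Summits.Ventures.PercRepro.S2SeriesCapSevenGen
import Summits.Ventures.PercRepro.S2CapFree
import Summits.Ventures.PercRepro.TriangleCapEightI
import Summits.Ventures.PercRepro.RankLevelSetFourCircuitNullityFour

/-!
# PercRepro — S2: THE PAYMENT CLOSURE OF THE CELL `(16, 7)` — THE CONCENTRATED HALF OF THE DICHOTOMY (p7, gen 10; sub-claim S2; the `p = 16` row)

The cell `(16, 7)` of the `q = 5` window (rank `16`, `23` points, nullity `7`, `e`-free, no coloop) reads `1.111` with the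
kit's caps `(s₃, s₄, s₅) ≤ (11, 46, 299)`: the `(U)`-side `31,614 + 2·26,712 + 185 = 85,223` against the need `78,230`
(tail `T = 537,149`, slack `m = 66`; the exact `Φ(16, 5) = 2041360/20349 ≤ 2^21/20905`, `K = 20905`). The loss is the
independent-`5`-set term: the `5`-element top sets are the COINDEPENDENT `5`-sets, and a set `W` of nullity `k` forces
`≥ 5 + k − 7` of their points into `W` (the nullity payment, S2CoindepCount): `V(w, k) = Σ_{j ≥ k − 2} C(w, j)·C(23 − w, 5 − j)`
in place of `31,614`, and the cell closes whenever `V ≤ 24,621`: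

* `c025_sixteen_seven_of_payment_five` — the cell from any `V ≥ #{B : |B| = 5, ρ(E ∖ B) = ρ(E)}` with `V ≤ 24,621`
  (S2PaymentCell's `c025_core_five_payment_cell_xqictq5g` at the caps `11 / 46 / 299`: `TriangleCap.core_ncard_triangles_le_cq3`,
  `S2.ncard_fourCircuits_le_of_seven_free_of_card` at `n = 23` (`s₄ ≤ 46 ∨ s₄ ≤ 42`), `S2.ncard_fiveCircuits_le_of_no_coloop`);
* **`c025_sixteen_seven_of_nullity_six`** — a set `W` of nullity `6` on `≤ 18` points (`V ≤ 23,868`; in `M✶`: a parallel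
  class of `≥ 5` points, i.e. a series class of `M` of `≥ 5` elements);
* **`c025_sixteen_seven_of_nullity_five`** — a set `W` of nullity `5` on `≤ 14` points (`V ≤ 24,115`; a line of `M✶` with `≥ 9` points);
* **`c025_sixteen_seven_of_nullity_four`** — a set `W` of nullity `4` on `≤ 9` points (`V ≤ 22,638`; a plane of `M✶` with `≥ 14` points);
* **`c025_sixteen_seven_of_concentrated`** — the three together.
The edges are sharp for this count: `|W| = 19 / 15 / 10` give `V = 27,132 / 26,663 / 25,212 > 24,621`. What remains OPEN at
`(16, 7)` is the SPREAD half — no such `W` — where the charge `2·val` on the `6`- and `7`-sets is the loss (the union bound over the small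
circuits is tight only when they are few and spread). Axioms: standard.
-/

open scoped Matroid

namespace PercRepro

namespace ThmN

open Set

variable {α : Type}

/-- **The cell `(16, 7)` from a bound on the coindependent `5`-sets**: on the `e`-free core of rank `16` with `23` points and
no coloop, `#{B ⊆ E : |B| = 5, ρ(E ∖ B) = ρ(E)} ≤ V ≤ 24,621` gives `RLS M 16 5` (caps `11 / 46 / 299`, slack `66/1024`,
`Φ(16, 5) ≤ 2^21/20905`). -/
theorem c025_sixteen_seven_of_payment_five (M : Matroid α) [M.Finite]
    (hR : M.eRank = ((16 : ℕ) : ℕ∞)) (hn : M.E.ncard = 16 + 7)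
    (hfree : ∀ e ∈ M.E, ∃ A ⊆ M.E \ {e}, e ∉ M.closure A ∧ e ∉ M.closure ((M.E \ {e}) \ A))
    (hK : ∀ e, ¬ M.IsColoop e) (V : ℕ)
    (hV : {B : Set α | B ⊆ M.E ∧ B.ncard = 5 ∧ M.eRk (M.E \ B) = M.eRank}.ncard ≤ V) (hV' : V ≤ 24621) :
    RLS M 16 5 := by
  classical
  have hd : M.E.encard = M.eRank + ((7 : ℕ) : ℕ∞) := by
    rw [hR, ← M.ground_finite.cast_ncard_eq, hn]
    push_cast
    ring
  -- the caps at `(16, 7)` on a coloop-free core: `s₃ ≤ 11`, `s₄ ≤ 46`, `s₅ ≤ 299`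
  have hs3 := TriangleCap.core_ncard_triangles_le_cq3 M hfree hd
  rw [show TriangleCap.cq3 7 = 11 by decide] at hs3
  have hcol : M.coloops = ∅ := S2.coloops_eq_empty_of_forall_not M hK
  have hs4' := S2.ncard_fourCircuits_le_of_seven_free_of_card M hfree (by exact_mod_cast hd) hn (by norm_num) hcol
    (fun M' _ hfree' hd5 => ncard_fourCircuits_le_avgChain16 5 M' hfree' hd5)
  have hs4 : {C : Set α | M.IsCircuit C ∧ C.ncard = 4}.ncard ≤ 46 := by
    rcases hs4' with h | h
    · exact h
    · norm_num at h
      omega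
  have hd6 : M.E.encard = M.eRank + (((6 : ℕ) : ℕ∞) + 1) := by
    rw [hd]; norm_num
  have hs5 := S2.ncard_fiveCircuits_le_of_no_coloop M hfree hd6 hK (by omega)
  rw [hn] at hs5
  have h299 : (16 + 7) * S1.avgChain5b 6 / (16 + 7 - 5) = 299 := by decide
  rw [h299] at hs5
  -- the exact constant against `K = 20905`
  have hΦ : phiK 16 5 ≤ (2 : ℚ) ^ (16 + 5) / ((20905 : ℕ) : ℚ) := by
    rw [S2.phiK_sixteen_five]; norm_num
  have hVq : (V : ℚ) ≤ 24621 := by exact_mod_cast hV'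
  rw [RLS_iff]
  refine c025_core_five_payment_cell_xqictq5g M 16 7 (by norm_num) hR hn hfree 11 46 299 hs3 hs4 hs5 V hV
    20905 (by norm_num) (phiK 16 5) hΦ ⟨66, by norm_num, ?_, ?_⟩
  · -- the polynomial side: `1024·(V + 2·26712 + 924/5) ≤ 958·4·20905`
    norm_num [Finset.sum_range_succ, Nat.choose]
    linarith
  · -- the tail side at `(16, 7)`, caps `11 / 46 / 299`: `T = 537,149 ≤ 66·2^23/1024`
    have hsm : (∑ j ∈ Finset.range (7), (Nat.choose (min 13 ((7 + 6) / 2 + 1 - 2)) j : ℚ) / (((j + 1) + 3 * (j + 1).choose 2 + 3 * (j + 1).choose 3 + 2 * (j + 1).choose 4 : ℕ) : ℚ)) = 12767 / 4230 := by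
      norm_num [Finset.sum_range_succ, Nat.choose]
    have hsg : (∑ j ∈ Finset.range (7), (Nat.choose (min 19 (5 + 7) - 6) j : ℚ) / (((j + 1) + 3 * (j + 1).choose 2 + 3 * (j + 1).choose 3 + 2 * (j + 1).choose 4 : ℕ) : ℚ)) = 414767 / 103635 := by
      norm_num [Finset.sum_range_succ, Nat.choose]
    have hs4m : (∑ j ∈ Finset.range 6, (Nat.choose (min 5 ((7 + 3) / 2 + 1 - 2)) j : ℚ) / (((j + 1) + 3 * (j + 1).choose 2 + 3 * (j + 1).choose 3 + 2 * (j + 1).choose 4 : ℕ) : ℚ)) = 523 / 225 := by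
      norm_num [Finset.sum_range_succ, Nat.choose]
    have hs4g : (∑ j ∈ Finset.range 6, (Nat.choose 5 j : ℚ) / (((j + 1) + 3 * (j + 1).choose 2 + 3 * (j + 1).choose 3 + 2 * (j + 1).choose 4 : ℕ) : ℚ)) = 12767 / 4230 := by
      norm_num [Finset.sum_range_succ, Nat.choose]
    rw [hsm, hsg, hs4m, hs4g]
    simp only [Finset.sum_range_succ, Finset.sum_range_zero]
    norm_num [Nat.choose]

/-- **`(16, 7)` closes on a set `W` of nullity `6` with `≤ 18` points** (the coindependent `5`-sets have `≥ 4` points in `W`: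
`V(w, 6) = C(w, 4)·(23 − w) + C(w, 5) ≤ 23,868`; in `M✶` a parallel class of `≥ 5` points). -/
theorem c025_sixteen_seven_of_nullity_six (M : Matroid α) [M.Finite]
    (hR : M.eRank = ((16 : ℕ) : ℕ∞)) (hn : M.E.ncard = 16 + 7)
    (hfree : ∀ e ∈ M.E, ∃ A ⊆ M.E \ {e}, e ∉ M.closure A ∧ e ∉ M.closure ((M.E \ {e}) \ A))
    (hK : ∀ e, ¬ M.IsColoop e) {W : Set α} (hW : W ⊆ M.E) (hWn : W.ncard ≤ 18)
    (hWk : W.encard = M.eRk W + 6) : RLS M 16 5 := by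
  have hd : M.E.encard = M.eRank + ((7 : ℕ) : ℕ∞) := by
    rw [hR, ← M.ground_finite.cast_ncard_eq, hn]
    push_cast
    ring
  have hV := S2.ncard_spanning_compl_le_of_nullity M hW hd hWk (m := 5)
  have hsum : ∑ j ∈ Finset.Icc (5 + 6 - 7) 5, W.ncard.choose j * (M.E.ncard - W.ncard).choose (5 - j) ≤ 23868 := by
    rw [hn]
    generalize W.ncard = w at hWn ⊢
    interval_cases w <;> decide
  exact c025_sixteen_seven_of_payment_five M hR hn hfree hK 23868 (hV.trans hsum) (by norm_num)

/-- **`(16, 7)` closes on a set `W` of nullity `5` with `≤ 14` points** (`≥ 3` points of every coindependent `5`-set in `W`: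
`V(w, 5) ≤ 24,115`; in `M✶` a line with `≥ 9` points). -/
theorem c025_sixteen_seven_of_nullity_five (M : Matroid α) [M.Finite]
    (hR : M.eRank = ((16 : ℕ) : ℕ∞)) (hn : M.E.ncard = 16 + 7)
    (hfree : ∀ e ∈ M.E, ∃ A ⊆ M.E \ {e}, e ∉ M.closure A ∧ e ∉ M.closure ((M.E \ {e}) \ A))
    (hK : ∀ e, ¬ M.IsColoop e) {W : Set α} (hW : W ⊆ M.E) (hWn : W.ncard ≤ 14)
    (hWk : W.encard = M.eRk W + 5) : RLS M 16 5 := by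
  have hd : M.E.encard = M.eRank + ((7 : ℕ) : ℕ∞) := by
    rw [hR, ← M.ground_finite.cast_ncard_eq, hn]
    push_cast
    ring
  have hV := S2.ncard_spanning_compl_le_of_nullity M hW hd hWk (m := 5)
  have hsum : ∑ j ∈ Finset.Icc (5 + 5 - 7) 5, W.ncard.choose j * (M.E.ncard - W.ncard).choose (5 - j) ≤ 24115 := by
    rw [hn]
    generalize W.ncard = w at hWn ⊢
    interval_cases w <;> decide
  exact c025_sixteen_seven_of_payment_five M hR hn hfree hK 24115 (hV.trans hsum) (by norm_num)

/-- **`(16, 7)` closes on a set `W` of nullity `4` with `≤ 9` points** (`≥ 2` points of every coindependent `5`-set in `W`: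
`V(w, 4) ≤ 22,638`; in `M✶` a plane with `≥ 14` points). -/
theorem c025_sixteen_seven_of_nullity_four (M : Matroid α) [M.Finite]
    (hR : M.eRank = ((16 : ℕ) : ℕ∞)) (hn : M.E.ncard = 16 + 7)
    (hfree : ∀ e ∈ M.E, ∃ A ⊆ M.E \ {e}, e ∉ M.closure A ∧ e ∉ M.closure ((M.E \ {e}) \ A))
    (hK : ∀ e, ¬ M.IsColoop e) {W : Set α} (hW : W ⊆ M.E) (hWn : W.ncard ≤ 9)
    (hWk : W.encard = M.eRk W + 4) : RLS M 16 5 := by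
  have hd : M.E.encard = M.eRank + ((7 : ℕ) : ℕ∞) := by
    rw [hR, ← M.ground_finite.cast_ncard_eq, hn]
    push_cast
    ring
  have hV := S2.ncard_spanning_compl_le_of_nullity M hW hd hWk (m := 5)
  have hsum : ∑ j ∈ Finset.Icc (5 + 4 - 7) 5, W.ncard.choose j * (M.E.ncard - W.ncard).choose (5 - j) ≤ 22638 := by
    rw [hn]
    generalize W.ncard = w at hWn ⊢
    interval_cases w <;> decide
  exact c025_sixteen_seven_of_payment_five M hR hn hfree hK 22638 (hV.trans hsum) (by norm_num)

/-- **The concentrated half of the `(16, 7)` dichotomy**: the cell closes on every `e`-free coloop-free core of rank `16` on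
`23` points carrying a set `W` with `(ν(W) = 6, |W| ≤ 18)`, `(ν(W) = 5, |W| ≤ 14)` or `(ν(W) = 4, |W| ≤ 9)`. -/
theorem c025_sixteen_seven_of_concentrated (M : Matroid α) [M.Finite]
    (hR : M.eRank = ((16 : ℕ) : ℕ∞)) (hn : M.E.ncard = 16 + 7)
    (hfree : ∀ e ∈ M.E, ∃ A ⊆ M.E \ {e}, e ∉ M.closure A ∧ e ∉ M.closure ((M.E \ {e}) \ A))
    (hK : ∀ e, ¬ M.IsColoop e)
    (hconc : ∃ W ⊆ M.E, (W.ncard ≤ 18 ∧ W.encard = M.eRk W + 6) ∨ (W.ncard ≤ 14 ∧ W.encard = M.eRk W + 5) ∨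
      (W.ncard ≤ 9 ∧ W.encard = M.eRk W + 4)) : RLS M 16 5 := by
  obtain ⟨W, hW, h6 | h5 | h4⟩ := hconc
  · exact c025_sixteen_seven_of_nullity_six M hR hn hfree hK hW h6.1 h6.2
  · exact c025_sixteen_seven_of_nullity_five M hR hn hfree hK hW h5.1 h5.2
  · exact c025_sixteen_seven_of_nullity_four M hR hn hfree hK hW h4.1 h4.2

end ThmN

end PercRepro
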